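import Summits.KontsevichZagierPeriods.KontsevichZagierPeriods.Theses.IsogenyCertificates
import Literature.NumberTheory.Transcendental.KZSubcalculusInvariants
import Literature.NumberTheory.Transcendental.SemialgebraicLineDeriv

/-!
# `GenusTwoRealPeriodCell` (stmt-KontsevichZagierPeriods-17657) — negative knowledge, part 2: witnesses, parity law, sub-calculi

Companion of `Negative/Core.lean` (standing disprover of the crux `GenusTwoRealPeriodCell`, work
file `Cruxes/GenusTwoRealPeriodCell/Disproof.lean`); the two files are independent. Theorems only
(`genSet` is a local notation for the literal generating set of the crux). Sorry-free findings:

* §4 WITNESSES on the curve `y² = x⁶ + 1` (`F = X⁶ + 1`: squarefree sextic, `{F>0} = ℝ`, so the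
  component through `q = 0` is the whole line and NO endpoint singularity occurs): honest sector
  representations `[ℝ, (a₀+a₁x)/√(x⁶+1)]` exist for all `a₀ a₁ ∈ ℚ` (`exists_rep`,
  `of_mem_genSet`).
* §5 VALUES. `[ℝ, 1/√(x⁶+1)]` has positive value; `[ℝ, x/√(x⁶+1)]` has value `0` (odd integrand on
  a symmetric domain — the general parity law `value_eq_zero_of_odd`, Lebesgue measure on `ℝⁿ` being
  negation invariant).
* §6 LOAD-BEARING / SUB-CALCULUS ANALYSIS. `eval c = 0` is load-bearing (`false_without_eval`).
  PARITY LAW on the sector (`value_eq_zero_of_even`): for even `F` the generator through `q = 0`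
  with `a₀ = 0` has value `0`. Hence GENERATOR NON-DEGENERACY FAILS in genus 2
  (`not_generator_nondegenerate`): unlike the genus-one real-period cell (integrand `a/√P` of one
  sign), a non-zero generator of this sector can have value `0`, so the kernel of `eval` on the
  sector contains SINGLE generators, and no independence/normal-form argument can start before
  quotienting by the parity (bielliptic `x ↦ −x`) degeneracy. Every certificate of such a one-term
  relation uses an additivity move (`false_without_additivity`, invariant `KZ.coeffSum`) AND a
  change-of-variables or Newton–Leibniz move (`false_without_cov_nl`, invariant
  `KZ.restrictedEval` on the window `{x₀ > 0}`).

Sources: M. Kontsevich, D. Zagier, *Periods* (2001), §§1.1–1.2; J. Bochnak, M. Coste, M.-F. Roy,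
*Real Algebraic Geometry* (1998), §2.2 (semialgebraic functions).
-/

noncomputable section

namespace Summit.KontsevichZagierPeriods.GenusTwoRealPeriodCell.Negative

open Literature.NumberTheory.Transcendental
open Literature.ModelTheory.ExponentialFields
open Summit.KontsevichZagierPeriods.KontsevichZagierPeriods.Theses.IsogenyCertificates
open Set MeasureTheory Polynomial

-- The generating set of the genus-two sector, literally as in the crux (local notation, as in
-- `Negative/Core.lean`).
set_option quotPrecheck false in
local notation "genSet" =>
  ({d | ∃ (F : Polynomial ℚ) (q a₀ a₁ : ℚ) (r : KZ.IntegralRep 1),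
    Squarefree F ∧ (F.natDegree = 5 ∨ F.natDegree = 6) ∧ 0 < Polynomial.aeval (q : ℝ) F ∧
    r.domain = {x | x 0 ∈ connectedComponentIn {y : ℝ | 0 < Polynomial.aeval y F} (q : ℝ)} ∧
    Set.EqOn r.integrand
      (fun x => ((a₀ : ℝ) + (a₁ : ℝ) * x 0) / Real.sqrt (Polynomial.aeval (x 0) F)) r.domain ∧
    d = KZ.of r} : Set KZ.FormalRep)

/-! ### §4 The curve `y² = x⁶ + 1`: sector representations without endpoint singularities -/

/-- `X⁶ + 1` evaluates to `y⁶ + 1`. [folklore] -/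
@[simp] theorem aeval_F6 (y : ℝ) : Polynomial.aeval y (X ^ 6 + 1 : ℚ[X]) = y ^ 6 + 1 := by
  simp

/-- `X⁶ + 1 ∈ ℚ[X]` is squarefree (it is `X⁶ − C(−1)`, separable in characteristic `0`). [folklore] -/
theorem squarefree_F6 : Squarefree (X ^ 6 + 1 : ℚ[X]) := by
  have h : (X ^ 6 + 1 : ℚ[X]) = X ^ 6 - C (-1) := by
    rw [map_neg, map_one, sub_neg_eq_add]
  rw [h]
  exact (Polynomial.separable_X_pow_sub_C (-1 : ℚ) (by norm_num) (by norm_num)).squarefree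

/-- `X⁶ + 1` has degree `6`. [folklore] -/
theorem natDegree_F6 : (X ^ 6 + 1 : ℚ[X]).natDegree = 6 := by
  rw [show (1 : ℚ[X]) = C 1 from (map_one C).symm, Polynomial.natDegree_X_pow_add_C]

/-- `F(0) = 1 > 0` for `F = X⁶ + 1`. [folklore] -/
theorem aeval_zero_F6_pos : 0 < Polynomial.aeval ((0 : ℚ) : ℝ) (X ^ 6 + 1 : ℚ[X]) := by
  simp

/-- `{F > 0} = ℝ` for `F = X⁶ + 1`. [folklore] -/
theorem setOf_pos_F6 : {y : ℝ | 0 < Polynomial.aeval y (X ^ 6 + 1 : ℚ[X])} = univ := by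
  ext y
  simp only [aeval_F6, mem_setOf_eq, mem_univ, iff_true]
  positivity

/-- The component of `{F > 0} = ℝ` through `0` is the whole line. [folklore] -/
theorem component_F6 :
    connectedComponentIn {y : ℝ | 0 < Polynomial.aeval y (X ^ 6 + 1 : ℚ[X])} ((0 : ℚ) : ℝ) = univ := by
  rw [setOf_pos_F6, connectedComponentIn_univ, PreconnectedSpace.connectedComponent_eq_univ]

/-- The integrand `(a₀ + a₁x)/√(x⁶+1)` is a `ℚ`-semialgebraic function on `ℝ¹` (a polynomial times
the square root of a rational function). [cite: BochnakCosteRoy1998, Prop. 2.2.6] -/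
theorem isSemialgebraicFunOn_integrand (a₀ a₁ : ℚ) :
    IsSemialgebraicFunOn ℚ (univ : Set (Fin 1 → ℝ))
      (fun x : Fin 1 → ℝ => ((a₀ : ℝ) + (a₁ : ℝ) * x 0) / Real.sqrt (x 0 ^ 6 + 1)) := by
  have hs : IsSemialgebraic ℚ (univ : Set (Fin 1 → ℝ)) := isSemialgebraic_univ
  have h1 := isSemialgebraicFunOn_aeval (k := ℚ) (R := ℝ) hs
    (MvPolynomial.C a₀ + MvPolynomial.C a₁ * MvPolynomial.X 0 : MvPolynomial (Fin 1) ℚ)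
  have h2 := isSemialgebraicFunOn_aeval_div_aeval (k := ℚ) (R := ℝ) hs (1 : MvPolynomial (Fin 1) ℚ)
    (MvPolynomial.X 0 ^ 6 + 1) (fun x _ => by
      simp only [map_add, map_pow, MvPolynomial.aeval_X, map_one]
      positivity)
  have h3 : IsSemialgebraicFunOn ℚ (univ : Set (Fin 1 → ℝ))
      (fun x : Fin 1 → ℝ => Real.sqrt (1 / (x 0 ^ 6 + 1))) :=
    (h2.congr (fun x _ => by simp)).fun_sqrt
  refine (h1.fun_mul h3).congr (fun x _ => ?_)
  simp only [map_add, map_mul, MvPolynomial.aeval_C, MvPolynomial.aeval_X, eq_ratCast,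
    Real.sqrt_inv, div_eq_mul_inv, one_mul]

/-- `1/√(t⁶+1) ≤ 2/(1+t²)` on `ℝ`. [folklore] -/
theorem one_div_sqrt_le (t : ℝ) : 1 / Real.sqrt (t ^ 6 + 1) ≤ 2 * (1 + t ^ 2)⁻¹ := by
  have hs : 0 < Real.sqrt (t ^ 6 + 1) := Real.sqrt_pos.2 (by positivity)
  have hq : 0 < 1 + t ^ 2 := by positivity
  have key : 1 * (1 + t ^ 2) ≤ 2 * Real.sqrt (t ^ 6 + 1) := by
    have h2 : (1 * (1 + t ^ 2)) ^ 2 ≤ (2 * Real.sqrt (t ^ 6 + 1)) ^ 2 := by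
      rw [mul_pow, mul_pow, Real.sq_sqrt (by positivity)]
      nlinarith [mul_nonneg (sq_nonneg t) (sq_nonneg (t ^ 2 - 1)), sq_nonneg (t ^ 2 - 3 / 7)]
    exact (pow_le_pow_iff_left₀ (by positivity) (by positivity) two_ne_zero).1 h2
  rw [div_le_iff₀ hs]
  calc (1 : ℝ) = 1 * (1 + t ^ 2) * (1 + t ^ 2)⁻¹ := by field_simp
    _ ≤ 2 * Real.sqrt (t ^ 6 + 1) * (1 + t ^ 2)⁻¹ := by gcongr
    _ = 2 * (1 + t ^ 2)⁻¹ * Real.sqrt (t ^ 6 + 1) := by ring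

/-- `|t|/√(t⁶+1) ≤ 2/(1+t²)` on `ℝ`. [folklore] -/
theorem abs_div_sqrt_le (t : ℝ) : |t| / Real.sqrt (t ^ 6 + 1) ≤ 2 * (1 + t ^ 2)⁻¹ := by
  have hs : 0 < Real.sqrt (t ^ 6 + 1) := Real.sqrt_pos.2 (by positivity)
  have hq : 0 < 1 + t ^ 2 := by positivity
  have key : |t| * (1 + t ^ 2) ≤ 2 * Real.sqrt (t ^ 6 + 1) := by
    have h2 : (|t| * (1 + t ^ 2)) ^ 2 ≤ (2 * Real.sqrt (t ^ 6 + 1)) ^ 2 := by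
      rw [mul_pow, mul_pow, sq_abs, Real.sq_sqrt (by positivity)]
      nlinarith [mul_nonneg (sq_nonneg t) (sq_nonneg (t ^ 2 - 1)), sq_nonneg (t ^ 2 - 1 / 2)]
    exact (pow_le_pow_iff_left₀ (by positivity) (by positivity) two_ne_zero).1 h2
  rw [div_le_iff₀ hs]
  calc |t| = |t| * (1 + t ^ 2) * (1 + t ^ 2)⁻¹ := by field_simp
    _ ≤ 2 * Real.sqrt (t ^ 6 + 1) * (1 + t ^ 2)⁻¹ := by gcongr
    _ = 2 * (1 + t ^ 2)⁻¹ * Real.sqrt (t ^ 6 + 1) := by ring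

/-- Domination of the integrand by the integrable model `2(|a₀|+|a₁|)/(1+x²)`. [folklore] -/
theorem norm_integrand_le (a₀ a₁ : ℚ) (x : Fin 1 → ℝ) :
    ‖((a₀ : ℝ) + (a₁ : ℝ) * x 0) / Real.sqrt (x 0 ^ 6 + 1)‖ ≤
      (|(a₀ : ℝ)| + |(a₁ : ℝ)|) * (2 * (1 + x 0 ^ 2)⁻¹) := by
  have hs : 0 < Real.sqrt (x 0 ^ 6 + 1) := Real.sqrt_pos.2 (by positivity)
  rw [Real.norm_eq_abs, abs_div, abs_of_pos hs]
  calc |(a₀ : ℝ) + (a₁ : ℝ) * x 0| / Real.sqrt (x 0 ^ 6 + 1)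
      ≤ (|(a₀ : ℝ)| + |(a₁ : ℝ)| * |x 0|) / Real.sqrt (x 0 ^ 6 + 1) := by
        gcongr
        exact (abs_add_le _ _).trans (by rw [abs_mul])
    _ = |(a₀ : ℝ)| * (1 / Real.sqrt (x 0 ^ 6 + 1)) + |(a₁ : ℝ)| * (|x 0| / Real.sqrt (x 0 ^ 6 + 1)) := by
        ring
    _ ≤ |(a₀ : ℝ)| * (2 * (1 + x 0 ^ 2)⁻¹) + |(a₁ : ℝ)| * (2 * (1 + x 0 ^ 2)⁻¹) := by
        gcongr
        · exact one_div_sqrt_le (x 0)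
        · exact abs_div_sqrt_le (x 0)
    _ = (|(a₀ : ℝ)| + |(a₁ : ℝ)|) * (2 * (1 + x 0 ^ 2)⁻¹) := by ring

/-- The integrand is absolutely integrable on `ℝ¹` (comparison with `C/(1+x²)`, transported from
`ℝ` along the volume-preserving `x ↦ x 0`). [folklore] -/
theorem integrable_integrand (a₀ a₁ : ℚ) :
    Integrable (fun x : Fin 1 → ℝ => ((a₀ : ℝ) + (a₁ : ℝ) * x 0) / Real.sqrt (x 0 ^ 6 + 1))
      (volume : Measure (Fin 1 → ℝ)) := by
  have h1 : Integrable (fun t : ℝ => (|(a₀ : ℝ)| + |(a₁ : ℝ)|) * (2 * (1 + t ^ 2)⁻¹)) :=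
    (integrable_inv_one_add_sq.const_mul 2).const_mul _
  have h2 : Integrable (fun x : Fin 1 → ℝ => (|(a₀ : ℝ)| + |(a₁ : ℝ)|) * (2 * (1 + x 0 ^ 2)⁻¹))
      (volume : Measure (Fin 1 → ℝ)) := by
    have hmp : MeasurePreserving (fun x : Fin 1 → ℝ => x 0) volume volume :=
      volume_preserving_funUnique (Fin 1) ℝ
    have hemb : MeasurableEmbedding (fun x : Fin 1 → ℝ => x 0) :=
      (MeasurableEquiv.funUnique (Fin 1) ℝ).measurableEmbedding
    exact (hmp.integrable_comp_emb hemb).2 h1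
  refine h2.mono' ?_ (Filter.Eventually.of_forall (norm_integrand_le a₀ a₁))
  exact (by fun_prop : Measurable fun x : Fin 1 → ℝ =>
    ((a₀ : ℝ) + (a₁ : ℝ) * x 0) / Real.sqrt (x 0 ^ 6 + 1)).aestronglyMeasurable

/-- **The witnesses exist.** For all `a₀ a₁ ∈ ℚ` there is an honest integral representation
`[ℝ, (a₀+a₁x)/√(x⁶+1)]`: the half-period of `(a₀+a₁x)dx/y` over the (unique, unbounded) real branch
of `y² = x⁶ + 1`. [cite: KontsevichZagier2001, §1.1] -/
theorem exists_rep (a₀ a₁ : ℚ) : ∃ r : KZ.IntegralRep 1, r.domain = univ ∧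
    r.integrand = fun x : Fin 1 → ℝ => ((a₀ : ℝ) + (a₁ : ℝ) * x 0) / Real.sqrt (x 0 ^ 6 + 1) :=
  ⟨⟨univ, _, isSemialgebraic_univ, isSemialgebraicFunOn_integrand a₀ a₁,
    (integrable_integrand a₀ a₁).integrableOn⟩, rfl, rfl⟩

/-- Such a representation is a generator of the sector (`F = X⁶+1`, `q = 0`).
[cite: KontsevichZagier2001, §1.1] -/
theorem of_mem_genSet {a₀ a₁ : ℚ} {r : KZ.IntegralRep 1} (hd : r.domain = univ)
    (hi : r.integrand = fun x : Fin 1 → ℝ => ((a₀ : ℝ) + (a₁ : ℝ) * x 0) / Real.sqrt (x 0 ^ 6 + 1)) :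
    KZ.of r ∈ genSet := by
  refine ⟨X ^ 6 + 1, 0, a₀, a₁, r, squarefree_F6, Or.inr natDegree_F6, aeval_zero_F6_pos, ?_, ?_, rfl⟩
  · rw [component_F6, hd]
    simp
  · intro x _
    simp [hi]

/-! ### §5 Values: positivity and the parity law -/

/-- **Parity law.** An integral representation with a domain symmetric under `x ↦ −x` and an
integrand odd on it has value `0` (Lebesgue measure on `ℝⁿ` is invariant under negation). [folklore] -/
theorem value_eq_zero_of_odd {n : ℕ} (r : KZ.IntegralRep n)
    (hD : ∀ x, -x ∈ r.domain ↔ x ∈ r.domain)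
    (hf : ∀ x ∈ r.domain, r.integrand (-x) = -r.integrand x) : r.value = 0 := by
  have hmp : MeasurePreserving (fun x : (Fin n → ℝ) => -x) volume volume :=
    Measure.measurePreserving_neg (volume : Measure (Fin n → ℝ))
  have hemb : MeasurableEmbedding (fun x : (Fin n → ℝ) => -x) :=
    (MeasurableEquiv.neg (Fin n → ℝ)).measurableEmbedding
  have hpre : (fun x : (Fin n → ℝ) => -x) ⁻¹' r.domain = r.domain := by
    ext x
    simpa using hD x
  have h1 : ∫ x in r.domain, r.integrand (-x) = r.value := by
    have := hmp.setIntegral_preimage_emb hemb r.integrand r.domain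
    rwa [hpre] at this
  have h2 : ∫ x in r.domain, r.integrand (-x) = -r.value := by
    rw [KZ.IntegralRep.value, ← integral_neg]
    exact setIntegral_congr_fun (KZ.IntegralRep.measurableSet_domain_holds r) fun x hx => hf x hx
  linarith

/-- `[ℝ, x/√(x⁶+1)]` has value `0`: a NON-ZERO generator of the sector in the kernel of `eval`.
[folklore] -/
theorem value_eq_zero_of_odd_witness {r : KZ.IntegralRep 1} (hd : r.domain = univ)
    (hi : r.integrand = fun x : Fin 1 → ℝ => (((0 : ℚ) : ℝ) + ((1 : ℚ) : ℝ) * x 0) / Real.sqrt (x 0 ^ 6 + 1)) :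
    r.value = 0 :=
  value_eq_zero_of_odd r (fun x => by simp [hd]) fun x _ => by
    simp only [hi, Pi.neg_apply, Rat.cast_zero, Rat.cast_one, zero_add, one_mul]
    rw [show (-x 0) ^ 6 = x 0 ^ 6 by ring, neg_div]

/-- `[ℝ, 1/√(x⁶+1)]` has positive value. [folklore] -/
theorem value_pos_of_even_witness {r : KZ.IntegralRep 1} (hd : r.domain = univ)
    (hi : r.integrand = fun x : Fin 1 → ℝ => (((1 : ℚ) : ℝ) + ((0 : ℚ) : ℝ) * x 0) / Real.sqrt (x 0 ^ 6 + 1)) :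
    0 < r.value := by
  rw [KZ.IntegralRep.value, hd, hi, Measure.restrict_univ]
  have hpos : ∀ x : Fin 1 → ℝ, 0 < (((1 : ℚ) : ℝ) + ((0 : ℚ) : ℝ) * x 0) / Real.sqrt (x 0 ^ 6 + 1) :=
    fun x => by
      simp only [Rat.cast_one, Rat.cast_zero, zero_mul, add_zero]
      positivity
  refine (integral_pos_iff_support_of_nonneg (fun x => (hpos x).le) (integrable_integrand 1 0)).2 ?_
  have hsupp : Function.support
      (fun x : Fin 1 → ℝ => (((1 : ℚ) : ℝ) + ((0 : ℚ) : ℝ) * x 0) / Real.sqrt (x 0 ^ 6 + 1)) = univ :=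
    eq_univ_of_forall fun x => Function.mem_support.2 (hpos x).ne'
  rw [hsupp]
  exact isOpen_univ.measure_pos volume univ_nonempty

/-- The generating set is NOT contained in `ker eval` (an honest generator has positive value).
[folklore] -/
theorem genSet_not_subset_ker : ¬ genSet ⊆ (KZ.eval.ker : Set KZ.FormalRep) := fun h => by
  obtain ⟨r, hd, hi⟩ := exists_rep 1 0
  have h1 := h (of_mem_genSet hd hi)
  rw [SetLike.mem_coe, AddMonoidHom.mem_ker, KZ.eval_of] at h1
  exact (value_pos_of_even_witness hd hi).ne' h1

/-! ### §6 Load-bearing hypotheses and sub-calculi -/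

/-- **`eval c = 0` is load-bearing**: the crux with its only non-sector hypothesis dropped
("every element of the sector is a relation") is false, by soundness of the calculus
(`KZ.relations_le_ker_eval_holds`) and the positive generator `[ℝ, 1/√(x⁶+1)]`. [folklore] -/
theorem false_without_eval : ¬ (∀ c ∈ AddSubgroup.closure genSet, c ∈ KZ.relations) := fun h =>
  genSet_not_subset_ker fun _ hd =>
    KZ.relations_le_ker_eval_holds (h _ (AddSubgroup.subset_closure hd))

/-- **Parity law on the sector.** For an EVEN `F` (`F(−x) = F(x)`), the generator through `q = 0`
with `a₀ = 0` has value `0` — whatever `F`'s degree or factorisation: the component of `{F>0}`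
through `0` is symmetric and `a₁x/√F` is odd on it. These are the one-term kernel elements of the
sector (bielliptic curves `y² = G(x²)`, form `x dx/y`, symmetric oval). [folklore] -/
theorem value_eq_zero_of_even {F : Polynomial ℚ} (hF : F.comp (-X) = F) (a₁ : ℚ)
    (r : KZ.IntegralRep 1)
    (hdom : r.domain = {x | x 0 ∈ connectedComponentIn {y : ℝ | 0 < Polynomial.aeval y F} ((0 : ℚ) : ℝ)})
    (hint : Set.EqOn r.integrand
      (fun x => (((0 : ℚ) : ℝ) + (a₁ : ℝ) * x 0) / Real.sqrt (Polynomial.aeval (x 0) F)) r.domain) :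
    r.value = 0 := by
  have heven : ∀ y : ℝ, Polynomial.aeval (-y) F = Polynomial.aeval y F := fun y => by
    conv_rhs => rw [← hF]
    simp [Polynomial.aeval_comp]
  set S : Set ℝ := {y : ℝ | 0 < Polynomial.aeval y F} with hS
  have hSneg : (Homeomorph.neg ℝ) '' S = S := by
    ext y
    simp only [Homeomorph.coe_neg, Set.image_neg_eq_neg, Set.mem_neg, hS, mem_setOf_eq, heven]
  have hcc : ∀ t : ℝ, -t ∈ connectedComponentIn S 0 ↔ t ∈ connectedComponentIn S 0 := by
    have key : ∀ t : ℝ, t ∈ connectedComponentIn S 0 → -t ∈ connectedComponentIn S 0 := by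
      intro t ht
      by_cases h0 : (0 : ℝ) ∈ S
      · have himg := (Homeomorph.neg ℝ).image_connectedComponentIn (s := S) h0
        rw [hSneg, Homeomorph.coe_neg, neg_zero] at himg
        rw [← himg]
        exact ⟨t, ht, rfl⟩
      · rw [connectedComponentIn_eq_empty h0] at ht
        exact ht.elim
    intro t
    refine ⟨fun h => ?_, key t⟩
    simpa using key (-t) h
  refine value_eq_zero_of_odd r (fun x => ?_) (fun x hx => ?_)
  · simp only [hdom, mem_setOf_eq, Pi.neg_apply, Rat.cast_zero]
    exact hcc (x 0)
  · have hx' : -x ∈ r.domain := by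
      simp only [hdom, mem_setOf_eq, Pi.neg_apply, Rat.cast_zero] at hx ⊢
      exact (hcc (x 0)).2 hx
    rw [hint hx', hint hx]
    simp only [Pi.neg_apply, Rat.cast_zero, zero_add, heven, mul_neg, neg_div]

/-- **Generator non-degeneracy FAILS in genus two** (refutation of the natural strengthening "a
generator of the sector with value `0` has `a₀ = a₁ = 0`", which does hold in the genus-one
real-period cell `[{P>0}, a/√P]`): witness `[ℝ, x/√(x⁶+1)]`. Consequently the kernel of `eval` on
the sector contains single generators, and any proof by "independence of the non-degenerate
generators + orbit collapse" must first quotient by the parity degeneracy. [folklore] -/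
theorem not_generator_nondegenerate :
    ¬ (∀ (F : Polynomial ℚ) (q a₀ a₁ : ℚ) (r : KZ.IntegralRep 1),
        Squarefree F → (F.natDegree = 5 ∨ F.natDegree = 6) → 0 < Polynomial.aeval (q : ℝ) F →
        r.domain = {x | x 0 ∈ connectedComponentIn {y : ℝ | 0 < Polynomial.aeval y F} (q : ℝ)} →
        Set.EqOn r.integrand
          (fun x => ((a₀ : ℝ) + (a₁ : ℝ) * x 0) / Real.sqrt (Polynomial.aeval (x 0) F)) r.domain →
        r.value = 0 → a₀ = 0 ∧ a₁ = 0) := fun h => by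
  obtain ⟨r, hd, hi⟩ := exists_rep 0 1
  refine one_ne_zero (h (X ^ 6 + 1) 0 0 1 r squarefree_F6 (Or.inr natDegree_F6) aeval_zero_F6_pos
    ?_ ?_ (value_eq_zero_of_odd_witness hd hi)).2
  · rw [component_F6, hd]
    simp
  · intro x _
    simp [hi]

/-- **Every certificate of the parity relation uses an additivity move**: the crux with
`KZ.relations` shrunk to the subgroup generated by rules (2) change of variables and (3)
Newton–Leibniz alone is FALSE — `KZ.coeffSum` kills those moves, and the one-term kernel element
`[ℝ, x/√(x⁶+1)]` has coefficient sum `1`. [cite: KontsevichZagier2001, §1.2] -/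
theorem false_without_additivity :
    ¬ (∀ c ∈ AddSubgroup.closure genSet, KZ.eval c = 0 →
        c ∈ AddSubgroup.closure (KZ.changeOfVariablesRel ∪ KZ.newtonLeibnizRel)) := fun h => by
  obtain ⟨r, hd, hi⟩ := exists_rep 0 1
  have h1 := KZ.closure_cov_nl_le_ker_coeffSum
    (h _ (AddSubgroup.subset_closure (of_mem_genSet hd hi))
      (by simp [value_eq_zero_of_odd_witness hd hi]))
  rw [AddMonoidHom.mem_ker, KZ.coeffSum_of] at h1
  exact one_ne_zero h1

/-- The positive-coordinate windows `{x | ∀ i, 0 < xᵢ} ⊆ ℝⁿ` are measurable. [folklore] -/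
theorem measurableSet_posWindow (n : ℕ) : MeasurableSet {x : Fin n → ℝ | ∀ i, 0 < x i} := by
  have : {x : Fin n → ℝ | ∀ i, 0 < x i} = ⋂ i, {x | 0 < x i} := by
    ext x
    simp
  rw [this]
  exact MeasurableSet.iInter fun i => measurableSet_lt measurable_const (measurable_pi_apply i)

/-- The odd generator has POSITIVE mass on the window `{x₀ > 0}`: `∫₀^∞ x dx/√(x⁶+1) > 0`.
[folklore] -/
theorem setIntegral_posWindow_pos :
    0 < ∫ x in (univ : Set (Fin 1 → ℝ)) ∩ {x : Fin 1 → ℝ | ∀ i, 0 < x i},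
      (((0 : ℚ) : ℝ) + ((1 : ℚ) : ℝ) * x 0) / Real.sqrt (x 0 ^ 6 + 1) := by
  rw [univ_inter]
  have hpos : ∀ x ∈ {x : Fin 1 → ℝ | ∀ i, 0 < x i},
      0 < (((0 : ℚ) : ℝ) + ((1 : ℚ) : ℝ) * x 0) / Real.sqrt (x 0 ^ 6 + 1) := fun x hx => by
    simp only [Rat.cast_zero, Rat.cast_one, zero_add, one_mul]
    exact div_pos (hx 0) (Real.sqrt_pos.2 (by positivity))
  have hae : 0 ≤ᵐ[volume.restrict {x : Fin 1 → ℝ | ∀ i, 0 < x i}]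
      fun x : Fin 1 → ℝ => (((0 : ℚ) : ℝ) + ((1 : ℚ) : ℝ) * x 0) / Real.sqrt (x 0 ^ 6 + 1) := by
    rw [Filter.EventuallyLE, ae_restrict_iff' (measurableSet_posWindow 1)]
    exact Filter.Eventually.of_forall fun x hx => (hpos x hx).le
  refine (setIntegral_pos_iff_support_of_nonneg_ae hae (integrable_integrand 0 1).integrableOn).2 ?_
  have hsub : {x : Fin 1 → ℝ | ∀ i, 0 < x i} ⊆
      Function.support (fun x : Fin 1 → ℝ =>
        (((0 : ℚ) : ℝ) + ((1 : ℚ) : ℝ) * x 0) / Real.sqrt (x 0 ^ 6 + 1)) ∩ {x | ∀ i, 0 < x i} :=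
    fun x hx => ⟨Function.mem_support.2 (hpos x hx).ne', hx⟩
  refine lt_of_lt_of_le ?_ (measure_mono hsub)
  have hopen : IsOpen {x : Fin 1 → ℝ | ∀ i, 0 < x i} := by
    have : {x : Fin 1 → ℝ | ∀ i, 0 < x i} = ⋂ i, {x | 0 < x i} := by
      ext x
      simp
    rw [this]
    exact isOpen_iInter_of_finite fun i => isOpen_lt continuous_const (continuous_apply i)
  exact hopen.measure_pos volume ⟨fun _ => 1, fun _ => one_pos⟩

/-- **Every certificate of the parity relation uses a change-of-variables or a Newton–Leibniz
move**: the crux with `KZ.relations` shrunk to the subgroup generated by the two ADDITIVITY rules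
(1a), (1b) alone is FALSE — the restricted evaluation `KZ.restrictedEval` on the windows
`{x | ∀ i, 0 < xᵢ}` kills those moves, and gives `∫₀^∞ x dx/√(x⁶+1) > 0` on `[ℝ, x/√(x⁶+1)]`.
[cite: KontsevichZagier2001, §1.2] -/
theorem false_without_cov_nl :
    ¬ (∀ c ∈ AddSubgroup.closure genSet, KZ.eval c = 0 →
        c ∈ AddSubgroup.closure (KZ.domainAddRel ∪ KZ.integrandAddRel)) := fun h => by
  obtain ⟨r, hd, hi⟩ := exists_rep 0 1
  have h1 := KZ.closure_add_le_ker_restrictedEval (fun n => {x : Fin n → ℝ | ∀ i, 0 < x i})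
    measurableSet_posWindow
    (h _ (AddSubgroup.subset_closure (of_mem_genSet hd hi))
      (by simp [value_eq_zero_of_odd_witness hd hi]))
  rw [AddMonoidHom.mem_ker, KZ.restrictedEval_of, hd, hi] at h1
  exact setIntegral_posWindow_pos.ne' h1

end Summit.KontsevichZagierPeriods.GenusTwoRealPeriodCell.Negative
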